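import Summits.ResolutionOfSingularities.ResolutionOfSingularities.Theorems.FrobeniusClosingSteerToricUnitExitEuler
import Summits.ResolutionOfSingularities.ResolutionOfSingularities.Theorems.FrobeniusClosingSteerToricUnitExitTarget
import Summits.ResolutionOfSingularities.ResolutionOfSingularities.Theorems.FrobeniusClosingSteerToricUnitExitDual

/-!
# Crux `Steer` (stmt-ResolutionOfSingularities-16345) — K-TX part 4d, the END THEOREM of case B for an ARBITRARY (fresh or stale) unit
# survivor: `u·W − h² ∉ 𝔮²` as soon as a residue-compatible transport `Φ` sends `u` to a Laurent monomial with a dual weight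

[cite: CossartPiltant2008, §4]; folklore (design: seat folder `D/res-D-brk-2/HANDOFF.md`, gen 6, "4d route REFINED").

Setting: `K` of characteristic `2`, `O` a valuation ring of `K`, `R ⊆ O` a subring with an ideal `𝔮` inside the centre, a RESIDUE-COMPATIBLE
ring map `Φ : R → L = κ(O)[Y]_𝔭` (`…ToricUnitExitTarget`), elements `u, W, h ∈ R` with `Φ W` a non-zero constant `w̄` and
`Y^{k⁻}·Φ u = γ·Y^{k⁺}` (`γ ≠ 0`, the variables of `k^±` being units of `O`), and weights `c` with `Σ_v (k⁺+k⁻)_v c_v ≠ 0` — for instance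
DUAL weights, `⟨c, k⁺ − k⁻⟩ = 1` (`…ToricUnitExitDual`), since `2 = 0`.  Then `u·W − h² ∉ 𝔮²`.
Proof: transport to `𝔪_L²` (`ResCompat.map_mem_sq`), clear the denominators of `Φ h` and the negative part `Y^{k⁻}`, pull back to
`κ(O)[Y]` along the injective localisation map, and apply the Euler end argument `sq_free_euler`.

This is the general replacement of `…ToricUnitExitFresh.fresh_unit_sub_sq_not_mem_sq` (FRESH tie-born units only); what remains for K-TX
part 4 is to CARRY `Φ`, the rows `k_j^±` and the dual weights `c_j` along the toric tower (`ResCompat.exists_extend_chart`,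
`ResCompat.exists_extend_locAtCentre`, `DualRows.div_step`, `DualRows.birth`) inside the generic Perron induction (`…SteerGenericPerron`).

Contents (namespace `…Theorems.SteerToricUnitExit`): `two_eq_zero_residueField`, `exists_mul_mem_sq_of_mem_maximalIdeal_sq`,
`unit_sub_sq_not_mem_sq`, `unit_sub_sq_not_mem_sq_of_dual`.
-/

-- single-problem summit: the doubled namespace component `ResolutionOfSingularities` is forced
set_option linter.dupNamespace false

open scoped BigOperators

noncomputable section

namespace Summit.ResolutionOfSingularities.ResolutionOfSingularities.Theorems.SteerToricUnitExit

open IsLocalRing MvPolynomial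

variable {K : Type} [Field K]

/-- In characteristic `2` the residue field of `O` has `2 = 0`. [folklore] -/
theorem two_eq_zero_residueField [CharP K 2] (O : ValuationSubring K) : (2 : ResidueField O) = 0 := by
  have h2K : (2 : K) = 0 := by simpa using CharP.cast_eq_zero K 2
  have h2 : (2 : O) = 0 := Subtype.ext (by push_cast; exact h2K)
  rw [← map_ofNat (residue O) 2, h2, map_zero]

/-- Pull-back from `𝔪_L²`: if `algebraMap P ∈ 𝔪_L²` (`L = A_𝔭`, `A` a domain) then `D₀·P ∈ 𝔭²` for some `D₀ ∉ 𝔭`. [folklore] -/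
theorem exists_mul_mem_sq_of_mem_maximalIdeal_sq (O : ValuationSubring K) [(kerRes O).IsPrime]
    (P : MvPolynomial (K × ℕ) (ResidueField O))
    (hP : algebraMap _ (Localization.AtPrime (kerRes O)) P ∈ maximalIdeal (Localization.AtPrime (kerRes O)) ^ 2) :
    ∃ D₀ : MvPolynomial (K × ℕ) (ResidueField O), D₀ ∉ kerRes O ∧ D₀ * P ∈ kerRes O ^ 2 := by
  rw [← Localization.AtPrime.map_eq_maximalIdeal, ← Ideal.map_pow,
    IsLocalization.mem_map_algebraMap_iff (kerRes O).primeCompl] at hP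
  obtain ⟨⟨⟨i, hi⟩, t⟩, ht⟩ := hP
  have hinj : Function.Injective (algebraMap (MvPolynomial (K × ℕ) (ResidueField O)) (Localization.AtPrime (kerRes O))) :=
    IsLocalization.injective _ (Ideal.primeCompl_le_nonZeroDivisors (kerRes O))
  refine ⟨t, t.2, ?_⟩
  have : algebraMap _ (Localization.AtPrime (kerRes O)) (P * t) = algebraMap _ _ i := by
    rw [map_mul]; exact ht
  rw [mul_comm, hinj this]; exact hi

/-- **The end theorem of case B (general unit survivor).** See the module docstring. [cite: CossartPiltant2008, §4]; folklore. -/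
theorem unit_sub_sq_not_mem_sq [CharP K 2] (O : ValuationSubring K) [(kerRes O).IsPrime]
    (R : Subring K) (hRO : R ≤ O.toSubring) (Φ : R →+* Localization.AtPrime (kerRes O)) (hΦ : ResCompat O R hRO Φ)
    (𝔮 : Ideal R) (h𝔮 : ∀ a : R, a ∈ 𝔮 → O.valuation (a : K) < 1)
    (u W h : R) (wbar : ResidueField O) (hw : wbar ≠ 0) (hW : Φ W = algebraMap (MvPolynomial (K × ℕ) (ResidueField O)) (Localization.AtPrime (kerRes O)) (C wbar))
    (kp km : K × ℕ →₀ ℕ) (γ : ResidueField O) (hγ : γ ≠ 0)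
    (hu : algebraMap (MvPolynomial (K × ℕ) (ResidueField O)) (Localization.AtPrime (kerRes O)) (monomial km 1) * Φ u =
      algebraMap (MvPolynomial (K × ℕ) (ResidueField O)) (Localization.AtPrime (kerRes O)) (C γ * monomial kp 1))
    (hvars : ∀ v ∈ (kp + km).support, O.valuation v.1 = 1)
    (c : K × ℕ → ResidueField O) (hpair : ((kp + km).sum fun v n => (n : ResidueField O) * c v) ≠ 0) :
    u * W - h ^ 2 ∉ 𝔮 ^ 2 := by
  classical
  intro hx
  set L := Localization.AtPrime (kerRes O) with hL
  have h1 : Φ (u * W - h ^ 2) ∈ maximalIdeal L ^ 2 := hΦ.map_mem_sq h𝔮 hx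
  -- `Φ h = γ₁ / s₁`
  obtain ⟨⟨γ₁, s₁⟩, hh⟩ := IsLocalization.mk'_surjective (kerRes O).primeCompl (Φ h)
  have hhs : Φ h * algebraMap _ L (s₁ : MvPolynomial (K × ℕ) (ResidueField O)) = algebraMap _ L γ₁ := by
    rw [← hh]; exact IsLocalization.mk'_spec L γ₁ s₁
  -- clear denominators: `Y^{2k⁻} s₁² Φ(uW − h²) = algebraMap P`
  set P : MvPolynomial (K × ℕ) (ResidueField O) :=
    (s₁ : MvPolynomial (K × ℕ) (ResidueField O)) ^ 2 * (C (γ * wbar) * monomial (kp + km) 1) - (monomial km 1 * γ₁) ^ 2 with hPdef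
  have hXP : algebraMap _ L (monomial km (1 : ResidueField O)) ^ 2 * algebraMap _ L (s₁ : MvPolynomial (K × ℕ) (ResidueField O)) ^ 2 *
      Φ (u * W - h ^ 2) = algebraMap _ L P := by
    have e1 : algebraMap _ L (monomial km (1 : ResidueField O)) ^ 2 * algebraMap _ L (s₁ : MvPolynomial (K × ℕ) (ResidueField O)) ^ 2 *
        Φ (u * W - h ^ 2) =
        (algebraMap _ L (monomial km (1 : ResidueField O)) * Φ u) * Φ W * algebraMap _ L (monomial km (1 : ResidueField O)) *
          algebraMap _ L (s₁ : MvPolynomial (K × ℕ) (ResidueField O)) ^ 2 -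
        (algebraMap _ L (monomial km (1 : ResidueField O)) * (Φ h * algebraMap _ L (s₁ : MvPolynomial (K × ℕ) (ResidueField O)))) ^ 2 := by
      rw [map_sub, map_mul, map_pow]; ring
    have hM : (monomial (kp + km) (1 : ResidueField O)) = monomial kp 1 * monomial km 1 := by
      rw [monomial_mul, mul_one]
    have hC : (C (γ * wbar) : MvPolynomial (K × ℕ) (ResidueField O)) = C γ * C wbar := map_mul C _ _
    rw [e1, hu, hW, hhs, hPdef, hM, hC]
    simp only [map_sub, map_mul, map_pow]
    ring
  have hPmem : algebraMap _ L P ∈ maximalIdeal L ^ 2 := by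
    rw [← hXP]; exact Ideal.mul_mem_left _ _ h1
  obtain ⟨D₀, hD₀, hD₀P⟩ := exists_mul_mem_sq_of_mem_maximalIdeal_sq O P hPmem
  -- the Euler end argument
  have hker : ∀ a : MvPolynomial (K × ℕ) (ResidueField O), a ∉ kerRes O ↔ (evalRes O).toRingHom a ≠ 0 := fun a => by
    rw [Ne, ← RingHom.mem_ker]; rfl
  refine sq_free_euler (two_eq_zero_residueField O) (evalRes O).toRingHom c (kp + km) hpair ?_ D₀ (s₁ : MvPolynomial (K × ℕ) (ResidueField O))
    (monomial km 1 * γ₁) (γ * wbar) (mul_ne_zero hγ hw) ((hker _).mp hD₀) ((hker _).mp s₁.2) ?_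
  · intro v hv
    have hv1 := hvars v hv
    have hmem : v.1 ∈ O := by rw [← O.valuation_le_one_iff]; exact hv1.le
    change evalRes O (X v) ≠ 0
    rw [evalRes_X, Ne, resK_eq_zero_iff O hmem, hv1]; exact lt_irrefl _
  · exact hD₀P

/-- **The end theorem with DUAL weights**: the hypothesis `⟨c, k⁺ − k⁻⟩ = 1` (as delivered by `DualRows.self`) suffices, `2` being `0`.
[cite: CossartPiltant2008, §4]; folklore. -/
theorem unit_sub_sq_not_mem_sq_of_dual [CharP K 2] (O : ValuationSubring K) [(kerRes O).IsPrime]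
    (R : Subring K) (hRO : R ≤ O.toSubring) (Φ : R →+* Localization.AtPrime (kerRes O)) (hΦ : ResCompat O R hRO Φ)
    (𝔮 : Ideal R) (h𝔮 : ∀ a : R, a ∈ 𝔮 → O.valuation (a : K) < 1)
    (u W h : R) (wbar : ResidueField O) (hw : wbar ≠ 0) (hW : Φ W = algebraMap (MvPolynomial (K × ℕ) (ResidueField O)) (Localization.AtPrime (kerRes O)) (C wbar))
    (kp km : K × ℕ →₀ ℕ) (γ : ResidueField O) (hγ : γ ≠ 0)
    (hu : algebraMap (MvPolynomial (K × ℕ) (ResidueField O)) (Localization.AtPrime (kerRes O)) (monomial km 1) * Φ u =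
      algebraMap (MvPolynomial (K × ℕ) (ResidueField O)) (Localization.AtPrime (kerRes O)) (C γ * monomial kp 1))
    (hvars : ∀ v ∈ (kp + km).support, O.valuation v.1 = 1)
    (c : K × ℕ → ResidueField O)
    (hdual : logPair c (kp.mapRange (fun n : ℕ => (n : ℤ)) (by simp) - km.mapRange (fun n : ℕ => (n : ℤ)) (by simp)) = 1) :
    u * W - h ^ 2 ∉ 𝔮 ^ 2 := by
  refine unit_sub_sq_not_mem_sq O R hRO Φ hΦ 𝔮 h𝔮 u W h wbar hw hW kp km γ hγ hu hvars c ?_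
  rw [← logPair_mapRange_natCast, Finsupp.mapRange_add (fun _ _ => by push_cast; rfl),
    logPair_add_eq_sub_of_two_eq_zero (two_eq_zero_residueField O), hdual]
  exact one_ne_zero

end Summit.ResolutionOfSingularities.ResolutionOfSingularities.Theorems.SteerToricUnitExit

end
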